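import Literature.Probability.Percolation.UniquenessInfiniteCluster
import HarnessLib

/-!
# Uniqueness of the infinite cluster for translation-invariant, ergodic, insertion-tolerant laws

Topic `Literature/Probability/Percolation`, namespace `Literature.StatMech`. The Burton–Keane argument
in the cut-ball form of Bollobás–Riordan, *Percolation* (2006), Ch. 5, Lemma 2 and Thm. 4, as
formalised for Bernoulli bond percolation in `UniquenessInfiniteCluster.lean`
(`Grimmett1999_numInfiniteClusters_le_one_holds`), uses only four properties of the law `P_p`:
it is carried by lattice configurations, it is invariant under the translations of `ℤ^d`,
translation-invariant events are trivial, and opening the finitely many edges of a box costs at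
most a constant factor of probability ("insertion tolerance"). This file runs the same proof for
an **arbitrary probability measure** `μ` on bond configurations of `ℤ^d` with these four
properties (`IsInsertionTolerantErgodic μ`) and concludes that `μ`-almost surely there is at most
one infinite cluster (`ae_numInfiniteClusters_le_one_of_isInsertionTolerantErgodic`).

This is the form in which the argument is invoked for dependent models, in particular by

* M. Aizenman, H. Duminil-Copin, V. Sidoravicius, *Random currents and continuity of Ising
  model's spontaneous magnetization*, Comm. Math. Phys. **334** (2015) 719–742, Thm. 2.5
  (arXiv:1311.1937v3, p. 10): "there exists at most one infinite cluster `ℙ_β`-almost surely …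
  The proof is based on a variation of the Burton-Keane argument [BK89]", from R2 (translation
  invariance), R3 (ergodicity) of Thm. 2.3 and the insertion tolerance Lemma 2.6
  ("`ℙ_β[Φ̂_N(𝓔)] ≥ c ℙ_β[𝓔]`", `Φ̂_N` = opening all edges of `Λ_N`);

the present file is the model-independent half of that theorem (the hypotheses for the double
random current `ℙ_β` are ADS15 Thm. 2.3 R2/R3 and Lemma 2.6).

## The proof (Bollobás–Riordan 2006, Ch. 5, pp. 105–109, verbatim from
`UniquenessInfiniteCluster.lean` with `P_p` replaced by `μ`)

* `P(`exactly two infinite clusters`) = 0` (B–R Lemma 2): otherwise some box `Λ_n` meets both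
  with positive probability; opening `Λ_n` (insertion tolerance) merges them
  (`openEdges_edgesIn_mem_exactlyOneInfCluster`), so `P(`exactly one`) > 0`; both events are
  invariant under every translation, hence trivial (ergodicity) — impossible, they are disjoint.
* `P(`at least three infinite clusters`) = 0` (B–R Thm. 4): otherwise some `Λ_r` meets three of
  them with positive probability; opening `Λ_r` makes it a cut-ball (`isCutSet_openEdges_of_three`)
  with probability `a > 0`, at least `a` at every centre (translation invariance); the expected
  number of cut-balls among `(2m+1)^d` disjoint translates in `Λ_n` is `≥ a(2m+1)^d` but at most
  `|∂ⁱⁿΛ_{n+1}| ≤ 2d(2n+3)^{d-1}` (`card_filter_cutBall_le`, deterministic, needs `ω ⊆ E(ℤ^d)`).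

All the combinatorics (`IsCutSet`, `cutBall`, `centres`, `card_filter_cutBall_le`,
`threeInBox`, `twoInBox`, the covering lemmas and the merge lemma) is imported from
`UniquenessInfiniteCluster.lean`; only the four measure-theoretic steps are redone.

## References

* B. Bollobás, O. Riordan, *Percolation*, CUP 2006, Ch. 5, Lemma 2 and Thm. 4 (pp. 105–109 of
  the held copy, printed pp. 117–124), as in `UniquenessInfiniteCluster.lean`. [BollobasRiordan2006]
* R. M. Burton, M. Keane, *Density and uniqueness in percolation*, Comm. Math. Phys. 121 (1989)
  501–505 (the argument for stationary finite-energy measures). [BurtonKeane1989]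
* M. Aizenman, H. Duminil-Copin, V. Sidoravicius, Comm. Math. Phys. 334 (2015), Thm. 2.5 and
  Lemma 2.6, p. 10 (arXiv v3). [AizenmanDuminilCopinSidoraviciusCMP2015]
-/

noncomputable section

namespace Literature.Probability.Percolation

open MeasureTheory ProbabilityTheory SimpleGraph Finset
open Percolation (shiftedBox mem_shiftedBox_iff shiftedBox_zero)
open scoped ENNReal

variable {d : ℕ}

/-! ### The hypotheses -/

/-- **A translation-invariant, ergodic, insertion-tolerant bond measure on `ℤ^d`** — the
hypotheses of the Burton–Keane uniqueness argument (Burton–Keane 1989; Bollobás–Riordan 2006,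
Ch. 5, Lemma 2 and Thm. 4 use exactly these properties of `P_p`; ADS15 Thm. 2.5 verifies them for
the double random current `ℙ_β`: R2, R3 of Thm. 2.3 and Lemma 2.6):
`μ` is carried by lattice configurations; `μ(A + v) = μ(A)` for every translation `v`;
every event invariant under all translations has probability `0` or `1`; and for every box
`Λ_N` there is `c > 0` with `μ(S) ≥ c · μ{ω : ω ∪ E(Λ_N) ∈ S}` for all events `S` (equivalently
`μ[Φ̂_N(𝓔)] ≥ c μ[𝓔]`, ADS15 Lemma 2.6, with `𝓔 = Φ̂_N⁻¹(S)`). [cite: AizenmanDuminilCopinSidoraviciusCMP2015, Thm. 2.5 and Lemma 2.6 (p. 10)] [cite: BollobasRiordan2006, Ch. 5, Lemma 2 and Thm. 4 (pp. 105–109)] -/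
structure IsInsertionTolerantErgodic (μ : Measure (BondConfig (LatticeModels.Site d))) : Prop where
  /-- `μ`-a.s. only lattice bonds are open. -/
  ae_subset_edgeSet : ∀ᵐ ω ∂μ, ω ⊆ (LatticeModels.zdGraph d).edgeSet
  /-- Translation invariance: `μ(A + v) = μ(A)`. -/
  measure_preimage_shift : ∀ (v : LatticeModels.Site d) {S : Set (BondConfig (LatticeModels.Site d))}, MeasurableSet S →
    μ (BondConfig.relabel (sym2Equiv (LatticeModels.Site.shift v)) ⁻¹' S) = μ S
  /-- Ergodicity: events invariant under all translations are trivial. -/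
  zero_one : ∀ {S : Set (BondConfig (LatticeModels.Site d))}, MeasurableSet S →
    (∀ v : LatticeModels.Site d, BondConfig.relabel (sym2Equiv (LatticeModels.Site.shift v)) ⁻¹' S = S) → μ S = 0 ∨ μ S = 1
  /-- Insertion tolerance: opening the edges of a box costs at most a factor `c(N) > 0`. -/
  insertion_tolerant : ∀ N : ℕ, ∃ c : ℝ, 0 < c ∧ ∀ {S : Set (BondConfig (LatticeModels.Site d))}, MeasurableSet S →
    c * μ.real (openEdges ↑(LatticeModels.edgesIn (LatticeModels.zdGraph d) (LatticeModels.box d N)) ⁻¹' S) ≤ μ.real S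

namespace IsInsertionTolerantErgodic

variable {μ : Measure (BondConfig (LatticeModels.Site d))}

/-- Insertion tolerance in the form used by the argument: if `A` has positive (outer) measure and
opening `Λ_N` maps `A` into the event `S`, then `μ(S) > 0`. [cite: AizenmanDuminilCopinSidoraviciusCMP2015, Lemma 2.6] -/
theorem real_pos_of_openEdges (h : IsInsertionTolerantErgodic μ) [IsFiniteMeasure μ] (N : ℕ)
    {A S : Set (BondConfig (LatticeModels.Site d))} (hS : MeasurableSet S) (hA : 0 < μ.real A)
    (hAS : ∀ ω ∈ A, openEdges ↑(LatticeModels.edgesIn (LatticeModels.zdGraph d) (LatticeModels.box d N)) ω ∈ S) : 0 < μ.real S := by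
  obtain ⟨c, hc, hcS⟩ := h.insertion_tolerant N
  have h1 : μ.real A ≤ μ.real (openEdges ↑(LatticeModels.edgesIn (LatticeModels.zdGraph d) (LatticeModels.box d N)) ⁻¹' S) :=
    measureReal_mono fun ω hω => hAS ω hω
  have h2 := hcS hS
  nlinarith [mul_pos hc (hA.trans_le h1)]

/-- Translation invariance of the cut-ball probability (Bollobás–Riordan 2006, Ch. 5, (2),
p. 107: "for all sites `x ∈ X₀` we have `P(T_r(x)) = a`"; the inequality is what is used). [cite: BollobasRiordan2006, Ch. 5, proof of Thm. 4 ((2), p. 107)] -/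
theorem real_cutBall_zero_le (h : IsInsertionTolerantErgodic μ) [IsFiniteMeasure μ] (c : LatticeModels.Site d) (r : ℕ) :
    μ.real (cutBall 0 r) ≤ μ.real (cutBall c r) := by
  have hsub : cutBall (0 : LatticeModels.Site d) r ⊆ BondConfig.relabel (sym2Equiv (LatticeModels.Site.shift c)) ⁻¹' cutBall c r := by
    simpa using cutBall_subset_preimage_shift (0 : LatticeModels.Site d) c r
  calc μ.real (cutBall 0 r)
      ≤ μ.real (BondConfig.relabel (sym2Equiv (LatticeModels.Site.shift c)) ⁻¹' cutBall c r) := measureReal_mono hsub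
    _ = μ.real (cutBall c r) := by
      simp only [measureReal_def]
      rw [h.measure_preimage_shift c (measurableSet_cutBall c r)]

/-- The expected number of cut-balls among the `(2m+1)^d` translates is at most `|∂ⁱⁿΛ_{n+1}|`
(pointwise bound `card_filter_cutBall_le` on lattice configurations, which carry `μ`). [cite: BollobasRiordan2006, Ch. 5, proof of Thm. 4 (p. 108)] -/
theorem sum_measure_cutBall_le (h : IsInsertionTolerantErgodic μ) [IsProbabilityMeasure μ] (r m : ℕ) :
    ∑ c ∈ centres r m, μ (cutBall c r) ≤
      (LatticeModels.innerBoundary (LatticeModels.zdGraph d) (LatticeModels.box d ((2 * r + 2) * m + r + 1))).card := by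
  classical
  set L := LatticeModels.innerBoundary (LatticeModels.zdGraph d) (LatticeModels.box d ((2 * r + 2) * m + r + 1)) with hL
  have h1 : ∑ c ∈ centres r m, μ (cutBall c r) =
      ∫⁻ ω, ∑ c ∈ centres r m, (cutBall c r).indicator 1 ω ∂μ := by
    rw [lintegral_finsetSum _ fun c _ => measurable_one.indicator (measurableSet_cutBall c r)]
    exact Finset.sum_congr rfl fun c _ => (lintegral_indicator_one (measurableSet_cutBall c r)).symm
  calc ∑ c ∈ centres r m, μ (cutBall c r)
        = ∫⁻ ω, ∑ c ∈ centres r m, (cutBall c r).indicator 1 ω ∂μ := h1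
    _ ≤ ∫⁻ _ω, (L.card : ℝ≥0∞) ∂μ := by
        refine lintegral_mono_ae ?_
        filter_upwards [h.ae_subset_edgeSet] with ω hω
        have hsum : ∑ c ∈ centres r m, (cutBall c r).indicator (1 : BondConfig (LatticeModels.Site d) → ℝ≥0∞) ω =
            (((centres r m).filter fun c => ω ∈ cutBall c r).card : ℝ≥0∞) := by
          simp only [Set.indicator_apply, Pi.one_apply]
          rw [Finset.sum_boole]
        rw [hsum]
        exact_mod_cast card_filter_cutBall_le r m hω
    _ = L.card := by rw [lintegral_const, measure_univ, mul_one]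

/-- **`μ(`at least three infinite clusters`) = 0`** for a translation-invariant, ergodic,
insertion-tolerant `μ` on `ℤ^d`, `d ≥ 1` (Bollobás–Riordan 2006, Ch. 5, Thm. 4, pp. 107–109;
Burton–Keane 1989): if not, some `Λ_r` meets three infinite clusters with positive probability;
opening `Λ_r` makes it a cut-ball, so `a = μ(T_r(0)) > 0` and `μ(T_r(c)) ≥ a` at every centre;
the expected number of cut-balls among `(2m+1)^d` disjoint translates in `Λ_n` is `≥ a(2m+1)^d`
and `≤ |∂ⁱⁿΛ_{n+1}| ≤ 2d(2r+3)^{d-1}(2m+1)^{d-1}`, false for `m` large. [cite: BollobasRiordan2006, Ch. 5, Thm. 4 (pp. 107–109)] -/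
theorem threeInfClusters_eq_zero (h : IsInsertionTolerantErgodic μ) [IsProbabilityMeasure μ]
    (hd : 1 ≤ d) : μ (threeInfClusters (LatticeModels.Site d)) = 0 := by
  classical
  by_contra h3
  -- some box meets three infinite clusters with positive probability
  obtain ⟨r, hr⟩ : ∃ r, μ (threeInBox (d := d) r) ≠ 0 := by
    by_contra hall
    push Not at hall
    exact h3 (measure_mono_null threeInfClusters_subset_iUnion (measure_iUnion_null_iff.2 hall))
  -- opening `Λ_r` on this event produces a cut-ball: `a = μ(T_r(0)) > 0`
  set A : Set (BondConfig (LatticeModels.Site d)) := threeInBox r ∩ {ω | ω ⊆ (LatticeModels.zdGraph d).edgeSet} with hA_def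
  have hAE : μ {ω : BondConfig (LatticeModels.Site d) | ω ⊆ (LatticeModels.zdGraph d).edgeSet}ᶜ = 0 := by
    rw [Set.compl_setOf]
    exact ae_iff.1 h.ae_subset_edgeSet
  have hA : 0 < μ.real A := by
    rw [measureReal_def, ENNReal.toReal_pos_iff]
    refine ⟨pos_iff_ne_zero.2 ?_, measure_lt_top _ _⟩
    rwa [hA_def, measure_inter_conull hAE]
  have hAT : ∀ ω ∈ A, openEdges ↑(LatticeModels.edgesIn (LatticeModels.zdGraph d) (LatticeModels.box d r)) ω ∈ cutBall (0 : LatticeModels.Site d) r := by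
    rintro ω ⟨⟨x, hxbox, hperc, hdis⟩, hωG⟩
    change IsCutSet (LatticeModels.zdGraph d) (shiftedBox 0 r) _
    rw [shiftedBox_zero]
    exact isCutSet_openEdges_of_three hωG hxbox hperc hdis
  have ha : 0 < μ.real (cutBall (0 : LatticeModels.Site d) r) :=
    h.real_pos_of_openEdges r (measurableSet_cutBall 0 r) hA hAT
  set a := μ.real (cutBall (0 : LatticeModels.Site d) r) with ha_def
  -- choose the number of translates
  set C₀ : ℕ := 2 * d * (2 * r + 3) ^ (d - 1) with hC₀
  obtain ⟨m, hm⟩ := exists_nat_gt ((C₀ : ℝ) / a)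
  have hm' : (C₀ : ℝ) < a * (2 * m + 1) := by
    rw [div_lt_iff₀ ha] at hm
    nlinarith
  set n := (2 * r + 2) * m + r with hn
  set L := LatticeModels.innerBoundary (LatticeModels.zdGraph d) (LatticeModels.box d (n + 1)) with hL
  -- lower bound for the expected number of cut-balls
  have hlow : ((2 * m + 1 : ℝ)) ^ d * a ≤ ∑ c ∈ centres r m, μ.real (cutBall c r) := by
    calc ((2 * m + 1 : ℝ)) ^ d * a = ∑ _c ∈ centres (d := d) r m, a := by
          rw [Finset.sum_const, card_centres, nsmul_eq_mul]; push_cast; ring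
      _ ≤ ∑ c ∈ centres r m, μ.real (cutBall c r) :=
          Finset.sum_le_sum fun c _ => h.real_cutBall_zero_le c r
  -- upper bound
  have hup : ∑ c ∈ centres r m, μ.real (cutBall c r) ≤ (L.card : ℝ) := by
    have h' := h.sum_measure_cutBall_le (d := d) r m
    have hsum : ∑ c ∈ centres r m, μ.real (cutBall c r) =
        (∑ c ∈ centres r m, μ (cutBall c r)).toReal := by
      rw [ENNReal.toReal_sum fun c _ => measure_ne_top _ _]
      rfl
    rw [hsum]
    have := ENNReal.toReal_mono (ENNReal.natCast_ne_top L.card) h'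
    simpa using this
  -- the boundary is small
  have hLcard : (L.card : ℝ) ≤ C₀ * (2 * m + 1 : ℝ) ^ (d - 1) := by
    have h1 := card_innerBoundary_box_le (d := d) (n + 1)
    have h2 : 2 * (n + 1) + 1 ≤ (2 * r + 3) * (2 * m + 1) := by
      have : (2 * r + 3) * (2 * m + 1) = 2 * (n + 1) + 1 + 2 * m := by rw [hn]; ring
      omega
    calc (L.card : ℝ) ≤ ((2 * d * (2 * (n + 1) + 1) ^ (d - 1) : ℕ) : ℝ) := by exact_mod_cast h1
      _ ≤ ((2 * d * ((2 * r + 3) * (2 * m + 1)) ^ (d - 1) : ℕ) : ℝ) := by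
          exact_mod_cast Nat.mul_le_mul_left _ (Nat.pow_le_pow_left h2 _)
      _ = C₀ * (2 * m + 1 : ℝ) ^ (d - 1) := by rw [hC₀]; push_cast; rw [mul_pow]; ring
  -- combine
  have hpow : (2 * m + 1 : ℝ) ^ d = (2 * m + 1) * (2 * m + 1) ^ (d - 1) := by
    conv_lhs => rw [← Nat.sub_add_cancel hd, pow_succ]
    ring
  have hchain := hlow.trans (hup.trans hLcard)
  rw [hpow] at hchain
  have hpos : (0 : ℝ) < (2 * m + 1) ^ (d - 1) := by positivity
  have key : (2 * m + 1 : ℝ) * a ≤ C₀ := by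
    have h' : ((2 * m + 1 : ℝ) * a) * (2 * m + 1) ^ (d - 1) ≤ (C₀ : ℝ) * (2 * m + 1) ^ (d - 1) := by
      linarith [hchain]
    exact le_of_mul_le_mul_right h' hpos
  linarith [key, hm']

/-- **`μ(`exactly two infinite clusters`) = 0`** for a translation-invariant, ergodic,
insertion-tolerant `μ` on `ℤ^d` (Bollobás–Riordan 2006, Ch. 5, Lemma 2, pp. 105–106, `k = 2`;
Newman–Schulman): if `μ(I₂) > 0` then some `T_{n,2}` has positive probability; opening `Λ_n`
there gives `I₁` (merge lemma), so `μ(I₁) > 0` by insertion tolerance; `I₁`, `I₂` are invariant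
under every translation, so both have probability `1` by ergodicity — impossible, they are
disjoint. [cite: BollobasRiordan2006, Ch. 5, Lemma 2 (pp. 105–106)] -/
theorem exactlyTwoInfClusters_eq_zero (h : IsInsertionTolerantErgodic μ) [IsProbabilityMeasure μ] :
    μ (exactlyTwoInfClusters (LatticeModels.Site d)) = 0 := by
  classical
  by_contra h2
  -- some `T_{n,2}` has positive probability
  obtain ⟨n, hn⟩ : ∃ n, μ (twoInBox (d := d) n) ≠ 0 := by
    by_contra hall
    push Not at hall
    exact h2 (measure_mono_null exactlyTwoInfClusters_subset_iUnion (measure_iUnion_null_iff.2 hall))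
  set A : Set (BondConfig (LatticeModels.Site d)) := twoInBox n ∩ {ω | ω ⊆ (LatticeModels.zdGraph d).edgeSet} with hA_def
  have hAE : μ {ω : BondConfig (LatticeModels.Site d) | ω ⊆ (LatticeModels.zdGraph d).edgeSet}ᶜ = 0 := by
    rw [Set.compl_setOf]
    exact ae_iff.1 h.ae_subset_edgeSet
  have hA : 0 < μ.real A := by
    rw [measureReal_def, ENNReal.toReal_pos_iff]
    refine ⟨pos_iff_ne_zero.2 ?_, measure_lt_top _ _⟩
    rwa [hA_def, measure_inter_conull hAE]
  -- opening `Λ_n` merges the two clusters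
  have hAT : ∀ ω ∈ A, openEdges ↑(LatticeModels.edgesIn (LatticeModels.zdGraph d) (LatticeModels.box d n)) ω ∈ exactlyOneInfCluster (LatticeModels.Site d) := by
    rintro ω ⟨⟨x, y, hx, hy, hpx, hpy, -, hall⟩, -⟩
    refine openEdges_edgesIn_mem_exactlyOneInfCluster
      (fun a ha b hb => box_withinGraph_reachable n ha hb) ⟨x, hpx⟩ fun z hz => ?_
    rcases hall z hz with h' | h'
    · exact ⟨x, hx, h'⟩
    · exact ⟨y, hy, h'⟩
  have h1 : 0 < μ.real (exactlyOneInfCluster (LatticeModels.Site d)) :=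
    h.real_pos_of_openEdges n measurableSet_exactlyOneInfCluster hA hAT
  -- ergodicity
  have hI1 : μ (exactlyOneInfCluster (LatticeModels.Site d)) = 1 := by
    rcases h.zero_one measurableSet_exactlyOneInfCluster
      (fun v => preimage_relabel_exactlyOneInfCluster (LatticeModels.Site.shift v)) with h' | h'
    · exfalso
      rw [measureReal_def, h'] at h1
      simp at h1
    · exact h'
  have hI2 : μ (exactlyTwoInfClusters (LatticeModels.Site d)) = 1 := by
    rcases h.zero_one measurableSet_exactlyTwoInfClusters
      (fun v => preimage_relabel_exactlyTwoInfClusters (LatticeModels.Site.shift v)) with h' | h'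
    · exact absurd h' h2
    · exact h'
  have hunion : μ (exactlyOneInfCluster (LatticeModels.Site d) ∪ exactlyTwoInfClusters (LatticeModels.Site d)) = 2 := by
    rw [measure_union disjoint_exactlyOne_exactlyTwo measurableSet_exactlyTwoInfClusters, hI1, hI2,
      one_add_one_eq_two]
  have hle := prob_le_one (μ := μ) (s := exactlyOneInfCluster (LatticeModels.Site d) ∪ exactlyTwoInfClusters (LatticeModels.Site d))
  rw [hunion] at hle
  exact absurd hle (not_le.2 ENNReal.one_lt_two)

end IsInsertionTolerantErgodic

/-- **Uniqueness of the infinite cluster for translation-invariant, ergodic, insertion-tolerant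
bond measures on `ℤ^d`** (Burton–Keane 1989; Bollobás–Riordan 2006, Ch. 5, Lemma 2 + Thm. 4;
the abstract form behind ADS15 Thm. 2.5): for every probability measure `μ` on bond
configurations of `ℤ^d` satisfying `IsInsertionTolerantErgodic μ`, `μ`-almost surely there is at
most one infinite cluster. If `N ≤ 1` fails there are exactly two or at least three infinite
clusters, and both events are null; for `d = 0` there is no infinite cluster. [cite: AizenmanDuminilCopinSidoraviciusCMP2015, Thm. 2.5 (proof, p. 10)] [cite: BollobasRiordan2006, Ch. 5, Lemma 2 and Thm. 4 (pp. 105–109)] -/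
theorem ae_numInfiniteClusters_le_one_of_isInsertionTolerantErgodic
    {μ : Measure (BondConfig (LatticeModels.Site d))} [IsProbabilityMeasure μ] (h : IsInsertionTolerantErgodic μ) :
    ∀ᵐ ω ∂μ, numInfiniteClusters ω ≤ 1 := by
  rcases Nat.eq_zero_or_pos d with hd | hd
  · -- `d = 0`: `ℤ⁰` is a single site, no cluster is infinite
    subst hd
    refine Filter.Eventually.of_forall fun ω => ?_
    rw [numInfiniteClusters_le_one_iff]
    intro x y hx
    exact absurd hx (Set.not_infinite.2 (Set.toFinite _))
  · rw [ae_iff]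
    refine measure_mono_null (fun ω hω => mem_union_of_not_numInfiniteClusters_le_one hω) ?_
    exact measure_union_null h.exactlyTwoInfClusters_eq_zero (h.threeInfClusters_eq_zero hd)

end Literature.Probability.Percolation
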